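import Summits.Parity.GeneralizedHardyLittlewood.Theses.LiouvilleOpening
import Summits.Parity.GeneralizedHardyLittlewood.Theses.DicksonFibration
import Summits.Parity.GeneralizedHardyLittlewood.Theorems.LeeYangFibresFibrationLemmaFinal
import Summits.Parity.GeneralizedHardyLittlewood.Theorems.LeeYangFibresPrimeCellsRelativeDimOneOne

/-!
# Crux `RelativePairsToGHL` (stmt-Parity-15917; route `LiouvilleOpening`, rank 5 — the route's
# DECLARED RESIDUAL; shared `closes`-hypothesis of route `PolynomialKatai`) — BIRTH SKELETON
# `Lines/birth.lean` (BC3): ORDER-BY-ORDER LIOUVILLE OPENING + ABSOLUTE UPGRADE + FIBRATION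

planner-skel-stmt-Parity-15917-0 (skeleton registrar, one-shot; route re-audit bin REPAIRABLE),
2026-08-17. Target: the route decl
`Summit.Parity.GeneralizedHardyLittlewood.Theses.LiouvilleOpening.RelativePairsToGHL` BY NAME
(rev 1 of the route file), concluded by `RelativePairsToGHL_of` from three named stubs;
`RelativePairsToGHL_proof` cites the registered stubs by name (it depends on `sorryAx` only through
them).

## The crux (fixed; not restated)

`RelativePairsToGHL := RelativePairs → GeneralizedHardyLittlewood`: relative Dickson–Hardy–Littlewood
for PAIRS (`t = 2`, `d = 1`, error `ε (1 + |𝔖_Ψ|) N`, uniform over non-degenerate pair systems with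
`‖Ψ‖_N ≤ L` and convex `K ⊆ [−N, N]`) implies Green–Tao's Conjecture 1.2 in every `(d, t)` with
absolute error `ε N^d`. Its content, as the route files it: higher-order parity (`t ≥ 3`) and the
absolute upgrade on systems with `𝔖_Ψ ≍ (log log N)^{t−1}`, composed with the tree's PROVED
fibration lemma `d = 1 ⇒ all d`.

## The line: the crux's content sorted by ORDER `t` and by PRECISION (relative / absolute)

Write `RelativeAt t` for relative Dickson–Hardy–Littlewood at `d = 1` for systems of `t` forms in
the route's own normalisation (error `ε (1 + |𝔖_Ψ|) N`; `RelativeAt 2` IS `RelativePairs`,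
`relativeAt_two_iff`). The composition assembles `∀ t ≥ 1, RelativeAt t` from three sources —
`t = 1`: the TREE (prime number theorem along one affine form, uniform in the shift:
`Cruxes.PrimeCellsRelative.Sketch.stub_dimOne_one`, a sorry-free Theorems decl — Green–Tao Thm. 1.2
at `t = 1`); `t = 2`: the crux's HYPOTHESIS `RelativePairs`; `t ≥ 3`: the route's own mechanism one
order up, i.e. the two stubs
* `stub_tupleLiouvilleLaw` (the `t`-TUPLE LIOUVILLE LAW, `t ≥ 3`; open, XL-to-open): for every `L`
  there is `K_L` such that, uniformly over non-degenerate `t`-systems with `‖Ψ‖_N ≤ L`, there is a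
  cofactor constant `c = c_{Ψ,N}` with `|c| ≤ K_L (1 + |𝔖_Ψ|)` and, for EVERY convex `K ⊆ [−N, N]`,
  `|Σ_{n∈K} Π_i Λ(ψ_i n) − β_∞ 𝔖_Ψ − c · Σ_{n∈K} Π_i λ(ψ_i n)| ≤ ε (1 + |𝔖_Ψ|) N` — the
  Hardy–Littlewood error of a `t`-system IS (a bounded multiple of) its `t`-point Chowla sum. The
  candidate constant is the `t`-fold Liouville cofactor Euler product
  `lim_y Σ_{k,b ∈ [1,y]^t} Π_i μ(k_i) λ(b_i) log b_i · dens_Ψ(k_1²b_1, …, k_t²b_t)` obtained by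
  opening EVERY factor `Λ(m) = λ(m) · Σ_{k²e ∣ m} μ(k) λ(e) log e` (complete multiplicativity), exactly
  as the route's rank-2 crux `PairLiouvilleLaw` does at `t = 2` (`tupleLawAt_two_of_pairLiouvilleLaw`:
  the explicit pair law implies the `t = 2` instance of this shape); it is left EXISTENTIAL here
  because only the bound `|c| ≤ K_L(1+|𝔖|)` is consumed and the `t`-fold local factors are unverified
  (route: "a local-factor slip changes 𝔠_Ψ"). At truncation `N^θ`, `tθ < ½`, the opening reduces the
  law to relative equidistribution of the `t`-point Chowla sequence in progressions plus multilinear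
  Kloosterman-fraction cores with `λ`-coefficients (route file, crux docstring; shared in kind with
  `DeterminantMoebiusCores.HigherCores`). [GreenTao2010 Conj. 1.2; DukeFriedlanderIwaniec1997 Thm 2;
  BettinChandee2018; MurtyVatwani2017; Vatwani2016 ch. 7]
* `stub_higherChowlaNatural` (`t`-POINT CHOWLA AT NATURAL DENSITY along affine systems, `t ≥ 3`;
  open): `|Σ_{n ∈ K∩ℤ} Π_i λ(ψ_i(n))| ≤ ε N` uniformly over non-degenerate `t`-systems with
  `‖Ψ‖_N ≤ L` and convex `K ⊆ [−N, N]` — the order-`t` companion of the route's rank-4 crux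
  `ChowlaNatural` (`chowlaNaturalAt_two_iff`), the line's ENTIRE parity input at order `t`. Known:
  logarithmically averaged for `t = 2` (TaoFMP2016) and odd `t` (TaoTeravainen2018 odd order), natural
  density for odd `t` at fixed shifts (TaoTeravainenDuke2019); open: even `t ≥ 4` at natural density,
  and the uniformity in shifts `≤ LN` (Siegel-complete, as `ChowlaNatural` is).
  [Chowla1965; TaoFMP2016; TaoTeravainenDuke2019; MatomakiRadziwillTao2015; HelfgottRadziwill2021]
and then removes the factor `(1 + |𝔖_Ψ|)`:
* `stub_relativeToAbsolute` (THE ABSOLUTE UPGRADE in the route's normalisation; open, rate-type):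
  `(∀ t ≥ 1, RelativeAt t) → DicksonFibration.DimOne` (error `ε N`). Content: on the aligned
  (primorial-shift) families `𝔖_Ψ` reaches `(e^γ log log N)^{t−1}`
  (`AbsoluteUpgrade.stub_singularProduct_le_loglog_pow` is the matching upper bound, in tree), so the
  upgrade is Hardy–Littlewood at relative precision `ε/(log log N)^{t−1}` there — a RATE. It implies
  the sibling crux `LeeYangFibres.AbsoluteUpgrade := RelativeDimOne → DimOne` (stmt-Parity-14116),
  whose hypothesis (error `ε(β_∞𝔖 + N)`) is stronger than `∀ t, RelativeAt t` since
  `β_∞ ≤ #(K∩ℤ) ≤ 2N+1`; that crux's kernel-checked position statements apply verbatim in kind: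
  `AbsoluteUpgrade ↔ (DimOne ∨ ¬RelativeDimOne)`, no black-box proof
  (`Theorems/AbsoluteUpgrade/Negative/AbsoluteUpgradeSchema.lean`: a functional with the relative
  shape and not the absolute one exists), census `Cruxes/AbsoluteUpgrade/STRATEGY-CENSUS.md`
  ("the rate IS the crux"; wall = binary minor arcs at aligned shifts, pointwise in the shift).
  [GreenTao2010 Conj. 1.2; HardyLittlewood1923; MontgomeryVaughan2007 §17]
Finally the tree's PROVED fibration lemma
`Theorems.FibrationGlue.generalizedHardyLittlewood_of_dimOne : DimOne → GeneralizedHardyLittlewood`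
(Theorems/LeeYangFibresFibrationLemmaFinal.lean; Green–Tao's remark after Conj. 1.2) lifts `d = 1`
to all `d`. That import is legitimate HERE (a crux workfile / future Theorems proof) and forbidden in
the route file (cone repair rev 1) — exactly as the crux docstring prescribes.

COMPOSITION `RelativePairsToGHL_of : Law → Chowla → Upgrade → RelativePairsToGHL` (real proof, no
`sorry`): for `t ≥ 3`, Law at `ε/2` and Chowla at `ε/(2(K'+1))`, `K' = max K_L 0`, give
`RelativeAt t` by `|S − M| ≤ |S − M − cC| + |c||C|` (the same two-line estimate as the route's
`closes`); `interval_cases` dispatches `t = 1` (tree) and `t = 2` (the hypothesis `RelativePairs`);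
Upgrade gives `DimOne`; the fibration lemma gives the summit conjunct. Every stub is consumed and the
crux's hypothesis is load-bearing (it is the only source of order 2).

WHAT THE CUT BUYS. The residual's three logically independent contents are separated and each is
matched to an existing programme: PARITY at order `t` = `stub_higherChowlaNatural` (Chowla–Elliott
technology; the statement every route of the summit must eventually pay at `t ≥ 3`);
DISTRIBUTION at order `t` = `stub_tupleLiouvilleLaw` (Bombieri–Vinogradov / Kloosterman-fraction /
dispersion technology with `λ`-coefficients — the route's mechanism one order up, killable by a
computation of the cofactor constant or a divergence); RATE = `stub_relativeToAbsolute` (shared in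
kind with stmt-Parity-14116 and its census). No stub mentions pairs: the pair content enters only
through the hypothesis.

## BC3 probes (registrar folder `bc/probe_first.lean`, `bc/probe_split.lean`: the same imports and
## vocabulary, the three stub STATEMENTS only — no stub theorem, no composition)

For each stub `S`: `S → RelativePairsToGHL` and `S → GeneralizedHardyLittlewood` by
`first | exact? | simpa | aesop` and by `exact?`, `simpa`, `aesop` separately,
`set_option maxHeartbeats 400000`: all FAIL (table in `Lines/birth.md`). No stub gives the crux:
Law/Chowla carry no order-2 and no absolute information; Upgrade needs `∀ t, RelativeAt t`, of
which the environment supplies only `t = 1` (and the crux's hypothesis only `t = 2`).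

## Disproof used / dead lines / negatives

None exist for this crux (2026-08-17): `ledger crux ls stmt-Parity-15917` — no workfiles before this
one, no `Disproof.lean`, no `_false_without_` theorem, no `Theorems/RelativePairsToGHL/Negative/*`.
Parity negatives index (3 statements: ConvMomentLevelOne 9541, TupleElliott 14832, rectangle-Chowla
4218): no stub is an instance — TupleElliott's witness is a pretentious `f = 1_{(·,z!)=1}` at fixed
exemption level, while `stub_higherChowlaNatural` fixes `f = λ` with no distance hypothesis; no
convolution moment, no rectangle average. Sibling negatives honoured: `stub_relativeToAbsolute` is a
statement about `vonMangoldtSum` itself, not an upgrade SCHEMA (`not_upgradeSchema`), and carries no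
saving exponent (`CellParityLawSavingLoadBearing`, `FibreHyperbolicityAlongLoadBearing` concern the
LeeYangFibres cell inputs, absent here).

Sources: GreenTao2010 (arXiv:math/0606088: Conj. 1.2 and the remark after it; Thm. 1.2 at t = 1);
Dickson1904; HardyLittlewood1923; Chowla1965; TaoFMP2016 (arXiv:1509.05422); TaoTeravainenDuke2019
(arXiv:1708.02610); TaoTeravainen2018 odd order (arXiv:1710.02112); MatomakiRadziwillTao2015
(arXiv:1503.05121); HelfgottRadziwill2021 (arXiv:2103.06853); DukeFriedlanderIwaniec1997 Thm 2;
BettinChandee2018; MurtyVatwani2017; Vatwani2016 ch. 7; LichtmanTeravainen2022; MontgomeryVaughan2007.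
-/

noncomputable section

namespace Summit.Parity.GeneralizedHardyLittlewood.Cruxes.RelativePairsToGHL.Birth

open scoped BigOperators Classical
open Finset Literature.NumberTheory.Sieve
open Summit.Parity.GeneralizedHardyLittlewood.Theses

/-! ## Vocabulary -/

/-- `RelativeAt t`: relative Dickson–Hardy–Littlewood at `d = 1` for systems of `t` forms in the
route's normalisation — uniformly over non-degenerate `Ψ : Fin t → AffLinForm 1` with `‖Ψ‖_N ≤ L`
and convex `K ⊆ [−N, N]`, `|Σ_{n∈K∩ℤ} Π_i Λ(ψ_i n) − β_∞ 𝔖_Ψ| ≤ ε (1 + |𝔖_Ψ|) N` for `N ≥ N₀(L, ε)`.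
`RelativeAt 2` is the route's target `RelativePairs` verbatim. [cite: GreenTao2010, Conj. 1.2] -/
def RelativeAt (t : ℕ) : Prop :=
  ∀ (L : ℕ) (ε : ℝ), 0 < ε → ∃ N₀ : ℕ, ∀ N : ℕ, N₀ ≤ N → ∀ Ψ : Fin t → AffLinForm 1,
    IsNondegenerateSystem Ψ → affLinSize Ψ N ≤ L → ∀ K : Set (Fin 1 → ℝ), Convex ℝ K →
      K ⊆ realBox 1 N →
        |vonMangoldtSum Ψ K N - archFactor Ψ K * singularProduct Ψ| ≤
          ε * (1 + |singularProduct Ψ|) * (N : ℝ)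

/-- The `t`-point Chowla sum of the Liouville function along the system over `K ∩ [−N, N] ∩ ℤ`
(terms with some `ψ_i(n) ≤ 0` vanish: `λ 0 = 0`) — the same expression as in the route's
`ChowlaNatural` / `PairLiouvilleLaw`. [cite: Chowla1965] -/
def chowlaSum {t : ℕ} (Ψ : Fin t → AffLinForm 1) (K : Set (Fin 1 → ℝ)) (N : ℕ) : ℝ :=
  ∑ n ∈ (latticeBox 1 N).filter (fun n => realPoint n ∈ K),
    ∏ i, ((ArithmeticFunction.liouville (Int.toNat ((Ψ i).eval n)) : ℤ) : ℝ)

/-- `ChowlaNaturalAt t`: `t`-point Chowla–Elliott for `λ` along `t` pairwise non-proportional affine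
forms in one variable, at NATURAL density, uniform over `‖Ψ‖_N ≤ L` and convex `K ⊆ [−N, N]`:
`|Σ_{n∈K∩ℤ} Π_i λ(ψ_i n)| ≤ ε N` for `N ≥ N₀(L, ε)`. `ChowlaNaturalAt 2` is the route's rank-4 crux
`ChowlaNatural`. [cite: Chowla1965] [cite: TaoFMP2016, Thm 1.1 (log-averaged, t = 2)] -/
def ChowlaNaturalAt (t : ℕ) : Prop :=
  ∀ (L : ℕ) (ε : ℝ), 0 < ε → ∃ N₀ : ℕ, ∀ N : ℕ, N₀ ≤ N → ∀ Ψ : Fin t → AffLinForm 1,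
    IsNondegenerateSystem Ψ → affLinSize Ψ N ≤ L → ∀ K : Set (Fin 1 → ℝ), Convex ℝ K →
      K ⊆ realBox 1 N → |chowlaSum Ψ K N| ≤ ε * (N : ℝ)

/-- `TupleLawAt t`: the `t`-TUPLE LIOUVILLE LAW with a bounded cofactor constant — for every `L`
there is `K_L` such that for every `ε > 0`, eventually in `N`, every non-degenerate `t`-system with
`‖Ψ‖_N ≤ L` admits a constant `c` with `|c| ≤ K_L (1 + |𝔖_Ψ|)` such that for EVERY convex
`K ⊆ [−N, N]`: `|Σ_{n∈K} Π_i Λ(ψ_i n) − β_∞ 𝔖_Ψ − c · Σ_{n∈K} Π_i λ(ψ_i n)| ≤ ε (1 + |𝔖_Ψ|) N`.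
Candidate `c`: the `t`-fold Liouville cofactor Euler product (explicit at `t = 2` in the route's
`PairLiouvilleLaw`, which implies `TupleLawAt 2`). [cite: MurtyVatwani2017, Thm 1.1 (one factor
opened, t = 2)] [cite: GreenTao2010, Conj. 1.2] -/
def TupleLawAt (t : ℕ) : Prop :=
  ∀ L : ℕ, ∃ Kc : ℝ, ∀ ε : ℝ, 0 < ε → ∃ N₀ : ℕ, ∀ N : ℕ, N₀ ≤ N → ∀ Ψ : Fin t → AffLinForm 1,
    IsNondegenerateSystem Ψ → affLinSize Ψ N ≤ L →
      ∃ c : ℝ, |c| ≤ Kc * (1 + |singularProduct Ψ|) ∧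
        ∀ K : Set (Fin 1 → ℝ), Convex ℝ K → K ⊆ realBox 1 N →
          |vonMangoldtSum Ψ K N - archFactor Ψ K * singularProduct Ψ - c * chowlaSum Ψ K N| ≤
            ε * (1 + |singularProduct Ψ|) * (N : ℝ)

/-! ## Sanity: the order-2 instances are the route's own items -/

/-- `RelativeAt 2` is the route's target `RelativePairs` (stmt-Parity-16146), definitionally.
[folklore] -/
theorem relativeAt_two_iff : RelativeAt 2 ↔ LiouvilleOpening.RelativePairs :=
  Iff.rfl

/-- `ChowlaNaturalAt 2` is the route's crux `ChowlaNatural` (stmt-Parity-16149), definitionally.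
[folklore] -/
theorem chowlaNaturalAt_two_iff : ChowlaNaturalAt 2 ↔ LiouvilleOpening.ChowlaNatural :=
  Iff.rfl

/-- The route's explicit pair law `PairLiouvilleLaw` (stmt-Parity-16147) implies the existential
order-2 law `TupleLawAt 2` (take `c` = the Liouville cofactor constant `𝔠_Ψ`). [folklore] -/
theorem tupleLawAt_two_of_pairLiouvilleLaw (h : LiouvilleOpening.PairLiouvilleLaw) :
    TupleLawAt 2 := by
  intro L
  obtain ⟨Kc, hK⟩ := h L
  refine ⟨Kc, fun ε hε => ?_⟩
  obtain ⟨N₀, hN₀⟩ := hK ε hε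
  refine ⟨N₀, fun N hN Ψ hΨ hL => ?_⟩
  obtain ⟨hc, hlaw⟩ := hN₀ N hN Ψ hΨ hL
  exact ⟨_, hc, fun K hK hKN => hlaw K hK hKN⟩

/-! ## Stub statements (named `Sig.stub_*` so that the skeleton theorem's hypotheses are the
registered obligations by name) -/

/-- STUB 1 — the `t`-TUPLE LIOUVILLE LAW for every `t ≥ 3` (the route's mechanism one order up:
distributional content, no parity claimed). [cite: GreenTao2010, Conj. 1.2]
[cite: DukeFriedlanderIwaniec1997, Thm 2] -/
def Sig.stub_tupleLiouvilleLaw : Prop :=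
  ∀ t : ℕ, 3 ≤ t → TupleLawAt t

/-- STUB 2 — `t`-POINT CHOWLA AT NATURAL DENSITY along affine systems for every `t ≥ 3` (the parity
input at order `t`). [cite: Chowla1965] [cite: TaoTeravainenDuke2019, Thm 1.3 (odd order)] -/
def Sig.stub_higherChowlaNatural : Prop :=
  ∀ t : ℕ, 3 ≤ t → ChowlaNaturalAt t

/-- STUB 3 — THE ABSOLUTE UPGRADE in the route's normalisation: relative Dickson–Hardy–Littlewood at
every order (error `ε(1+|𝔖|)N`) implies `DimOne` (error `εN`); implies the sibling crux
`LeeYangFibres.AbsoluteUpgrade` (stmt-Parity-14116). [cite: GreenTao2010, Conj. 1.2] -/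
def Sig.stub_relativeToAbsolute : Prop :=
  (∀ t : ℕ, 1 ≤ t → RelativeAt t) → DicksonFibration.DimOne

/-! ## Registered stubs (the ONLY `sorry`s of this file) -/

/-- Registered stub 1 (the `t`-tuple Liouville law, `t ≥ 3`). -/
theorem stub_tupleLiouvilleLaw : Sig.stub_tupleLiouvilleLaw := by
  sorry

/-- Registered stub 2 (`t`-point Chowla at natural density along affine systems, `t ≥ 3`). -/
theorem stub_higherChowlaNatural : Sig.stub_higherChowlaNatural := by
  sorry

/-- Registered stub 3 (the absolute upgrade `∀ t, RelativeAt t → DimOne`). -/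
theorem stub_relativeToAbsolute : Sig.stub_relativeToAbsolute := by
  sorry

/-! ## Bookkeeping lemmas for the composition (sorry-free) -/

/-- The ε/2-arithmetic of the route's `closes`, isolated: a law `|S − cC| ≤ (ε/2)(1+s)N` with
`|c| ≤ K'(1+s)` and a Chowla bound `|C| ≤ εN/(2(K'+1))` give `|S| ≤ ε(1+s)N`. [folklore] -/
theorem abs_le_of_law_of_small (S c C s N ε K' : ℝ) (hs : 0 ≤ s) (hN : 0 ≤ N) (hε : 0 < ε)
    (hK' : 0 ≤ K') (hc : |c| ≤ K' * (1 + s)) (h1 : |S - c * C| ≤ ε / 2 * (1 + s) * N)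
    (h2 : |C| ≤ ε / (2 * (K' + 1)) * N) : |S| ≤ ε * (1 + s) * N := by
  have htri : |S| ≤ |S - c * C| + |c| * |C| := by
    calc |S| = |(S - c * C) + c * C| := by ring_nf
      _ ≤ |S - c * C| + |c * C| := abs_add_le _ _
      _ = |S - c * C| + |c| * |C| := by rw [abs_mul]
  have hcC : |c| * |C| ≤ K' * (1 + s) * (ε / (2 * (K' + 1)) * N) :=
    mul_le_mul hc h2 (abs_nonneg _) (by positivity)
  have hK1 : K' / (K' + 1) ≤ 1 := by
    rw [div_le_one (by positivity)]; linarith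
  calc |S| ≤ |S - c * C| + |c| * |C| := htri
    _ ≤ ε / 2 * (1 + s) * N + K' * (1 + s) * (ε / (2 * (K' + 1)) * N) := add_le_add h1 hcC
    _ = ε / 2 * (1 + s) * N + (K' / (K' + 1)) * (ε / 2 * (1 + s) * N) := by
        field_simp
    _ ≤ ε / 2 * (1 + s) * N + 1 * (ε / 2 * (1 + s) * N) := by
        gcongr
    _ = ε * (1 + s) * N := by ring

/-- Law + Chowla at order `t` give relative Dickson–Hardy–Littlewood at order `t`. [folklore] -/
theorem relativeAt_of_law_of_chowla {t : ℕ} (hLaw : TupleLawAt t) (hCh : ChowlaNaturalAt t) :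
    RelativeAt t := by
  intro L ε hε
  obtain ⟨Kc, hK⟩ := hLaw L
  set K' : ℝ := max Kc 0 with hK'def
  have hK'0 : 0 ≤ K' := le_max_right _ _
  have hKle : Kc ≤ K' := le_max_left _ _
  obtain ⟨N₁, hN₁⟩ := hK (ε / 2) (by positivity)
  obtain ⟨N₂, hN₂⟩ := hCh L (ε / (2 * (K' + 1))) (by positivity)
  refine ⟨max N₁ N₂, fun N hN Ψ hΨ hL K hKc hKN => ?_⟩
  obtain ⟨c, hc, hlaw⟩ := hN₁ N (le_of_max_le_left hN) Ψ hΨ hL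
  have h1 := hlaw K hKc hKN
  have h2 := hN₂ N (le_of_max_le_right hN) Ψ hΨ hL K hKc hKN
  set s := |singularProduct Ψ| with hsdef
  have hs0 : 0 ≤ s := abs_nonneg _
  have hN0 : (0 : ℝ) ≤ N := Nat.cast_nonneg N
  have hc' := hc.trans
    (mul_le_mul_of_nonneg_right hKle (by positivity) : Kc * (1 + s) ≤ K' * (1 + s))
  exact abs_le_of_law_of_small _ _ _ s N ε K' hs0 hN0 hε hK'0 hc' h1 h2

/-- Order `t = 1` from the TREE: the prime number theorem along one affine form, uniform in the shift
(`Cruxes.PrimeCellsRelative.Sketch.stub_dimOne_one`, sorry-free, Green–Tao Thm. 1.2 at `t = 1`), and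
`ε N ≤ ε (1 + |𝔖|) N`. [cite: GreenTao2010, Thm. 1.2 (t = 1)] -/
theorem relativeAt_one : RelativeAt 1 := by
  intro L ε hε
  obtain ⟨N₀, hN₀⟩ := Cruxes.PrimeCellsRelative.Sketch.stub_dimOne_one L ε hε
  refine ⟨N₀, fun N hN Ψ hΨ hL K hK hKN => (hN₀ N hN Ψ hΨ hL K hK hKN).trans ?_⟩
  have hN0 : (0 : ℝ) ≤ N := Nat.cast_nonneg N
  have hs0 : 0 ≤ |singularProduct Ψ| := abs_nonneg _
  have h : 0 ≤ ε * |singularProduct Ψ| * (N : ℝ) := by positivity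
  nlinarith [h]

/-- All orders: `t = 1` from the tree, `t = 2` from the crux's hypothesis `RelativePairs`, `t ≥ 3`
from Law + Chowla. [folklore] -/
theorem relativeAt_all (hLaw : Sig.stub_tupleLiouvilleLaw) (hCh : Sig.stub_higherChowlaNatural)
    (hRP : LiouvilleOpening.RelativePairs) : ∀ t : ℕ, 1 ≤ t → RelativeAt t := by
  intro t ht
  rcases Nat.lt_or_ge t 3 with hlt | hge
  · interval_cases t
    · exact relativeAt_one
    · exact hRP
  · exact relativeAt_of_law_of_chowla (hLaw t hge) (hCh t hge)

/-! ## The composition: the three stubs imply the crux, by name -/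

/-- **THE SKELETON THEOREM.** `Law → Chowla → Upgrade →
Summit.Parity.GeneralizedHardyLittlewood.Theses.LiouvilleOpening.RelativePairsToGHL`, a real proof
(no `sorry`): given `RelativePairs`, `relativeAt_all` supplies every order, the Upgrade stub gives
`DimOne`, and the tree's proved fibration lemma
`Theorems.FibrationGlue.generalizedHardyLittlewood_of_dimOne` gives Green–Tao's Conjecture 1.2 in
every dimension. Every stub is consumed; the hypothesis `RelativePairs` is the only source of
order 2. [cite: GreenTao2010, remark after Conj. 1.2] -/
theorem RelativePairsToGHL_of :
    Sig.stub_tupleLiouvilleLaw → Sig.stub_higherChowlaNatural → Sig.stub_relativeToAbsolute →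
      Summit.Parity.GeneralizedHardyLittlewood.Theses.LiouvilleOpening.RelativePairsToGHL := by
  intro hLaw hCh hUp hRP
  exact Theorems.FibrationGlue.generalizedHardyLittlewood_of_dimOne (hUp (relativeAt_all hLaw hCh hRP))

/-- The skeleton in its final shape: the crux BY NAME from the three registered stubs; it becomes
the crux proof when the last `stub_*` is discharged (until then it depends on `sorryAx` through the
stubs only — no `sorry` of its own). [folklore] -/
theorem RelativePairsToGHL_proof :
    Summit.Parity.GeneralizedHardyLittlewood.Theses.LiouvilleOpening.RelativePairsToGHL :=
  RelativePairsToGHL_of stub_tupleLiouvilleLaw stub_higherChowlaNatural stub_relativeToAbsolute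

end Summit.Parity.GeneralizedHardyLittlewood.Cruxes.RelativePairsToGHL.Birth

end
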